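import Summits.BirchSwinnertonDyer.BirchSwinnertonDyer.Theorems.GenusKolyvaginAtTwoVisiblePairAtTwoCasselsTateLocalTermValue
import Summits.BirchSwinnertonDyer.BirchSwinnertonDyer.Theorems.GenusKolyvaginAtTwoVisiblePairAtTwoCasselsTateLocalInjective
import Summits.BirchSwinnertonDyer.BirchSwinnertonDyer.Theorems.GenusKolyvaginAtTwoEquivariantKolyvaginExactAtTwoLocalDualityOrder
import Literature.NumberTheory.EllipticCurves.CasselsTateFirstCase
import Literature.NumberTheory.GaloisCohomology.ArchimedeanInvariantMap
import HarnessLib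

/-!
# Route `GenusKolyvaginAtTwo`, crux `KolyvaginExactAtTwo` (22137) → Q3-inner: the local term of the
# Cassels–Tate pairing at a Kolyvagin prime of the `ℚ`-pair is NON-ZERO (McCallum's Lemma 5.3, instance)

Seat `bsd-line-gk2-p2` g12 (cell `bsd-f1-sign2`). THEOREMS ONLY (no definition, no named fact, no `sorry`).

Sequel to `…CasselsTateLocalTermValue` (§1, generic over a local `K`-field `F`: `ctLocalTerm_ne_zero_of_orders`).
Here the instance at a Kolyvagin prime `q` of level `2^{L+L}` of the `ℚ`-pair `(E, E^{(d_K)})` (`Δ(E) < 0`),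
`F = ℚ_q`, `m = 2^L`, `p = 2`, `n = L + L`, `inv` = THE invariant maps (`LocalInvariants.canonical`, injective at
the finite places by `canonical_isPerfect`):

* `localTerm_canonical_ne_zero_of_kolPrime` (member `E`): the counts `#H¹(ℚ_q, E)[2^k] = 2^k` (`k = L + L`, `1`)
  are this lineage's `…LocalDualityOrder.natCard_torsionBy_localH1_two_pow_eq`;
* `localTerm_canonical_ne_zero_twin_of_kolPrime` (member `E^{(d_K)}`, any model): the counts are
  `natCard_torsionBy_localH1_eq_of_not_mem` with `natCard_ker_nsmul_quadraticTwist_adicCompletion_two_pow_eq`.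

In both: for first-case data `D` (Milne I, proof of Prop. 6.9) with `2^a · res_q b₁ ∉ 𝓛_q`, `2^b · β'_q ≠ 0`,
`L + L ≤ a + b + 1`, the local term `t_q(D) = inv_q((res_q b₁ − β_q) ∪ β'_q) ≠ 0`. What remains for the
displayed `hloc₁`/`hloc₂` of `selmer_eq_and_card_selmer_twin_eq_of_localTerms` is the order bookkeeping
(`2^b t ∉ a₁(q)` ⇒ `2^{b+L} β'_q ≠ 0`; Prop. 4.4 + `2^{a+j−N} c₂(m') ∉ a₂(q)` ⇒ `2^{a−N+L} res_q b₁ ∉ 𝓛_q`).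

The `CharZero ℚ_q` instance is passed explicitly (a `haveI` would let `DivisionRing.toRatAlgebra` compete with
the completion's `ℚ`-algebra structure). BSD is not proved by any of this.

References: [McCallumLMS1991] §5 Lemma 5.3 and proof of Thm. 5.4; [MilneADT2006] I Cor. 2.3, Thm. 3.2, proof of
Prop. 6.9; [GrossLMS1991] §3.
-/

set_option linter.dupNamespace false -- tree convention: `Summit.BirchSwinnertonDyer.BirchSwinnertonDyer.Theorems` (summit = sub-problem)
set_option autoImplicit false

noncomputable section

open scoped Classical

namespace Summit.BirchSwinnertonDyer.BirchSwinnertonDyer.Theorems.GenusExact.VisiblePairAtTwo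

open WeierstrassCurve Field Function
open Literature.NumberTheory.EllipticCurves Literature.NumberTheory.GaloisRepresentations
open Literature.NumberTheory.GaloisRepresentations.DiscreteGaloisModule (mu)
open scoped ContRepresentation

/-! ## §2. The instance: the local term at a Kolyvagin prime of the `ℚ`-pair, `inv` = THE invariant maps -/

section Instance

open NumberField IsDedekindDomain Rat.HeightOneSpectrum Literature.NumberTheory.GaloisCohomology
open Summit.BirchSwinnertonDyer.BirchSwinnertonDyer.Theorems.GenusExact.LocalDualityOrder

variable {W : WeierstrassCurve ℚ} [W.IsElliptic] [W.IsGloballyMinimal] {K : Type} [Field K] [NumberField K]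

/-- **McCallum's Lemma 5.3 for the local term of the Cassels–Tate pairing at a Kolyvagin prime `q` of the
`ℚ`-pair, member `E`, with `inv` THE invariant maps of local class field theory** (`LocalInvariants.canonical`,
injective at the finite places: `canonical_isPerfect`). Level `m = 2^L`, auxiliary level `2^L · 2^L`, `q` a
Kolyvagin prime of level `2^{L+L}` (`Δ(E) < 0`, so `#H¹(ℚ_q, E)[2^k] = 2^k` for `k ≤ L + L`:
`…LocalDualityOrder.natCard_torsionBy_localH1_two_pow_eq`): for first-case data `D` with
`2^a · res_q b₁ ∉ 𝓛_q` and `2^b · β'_q ≠ 0`, `L + L ≤ a + b + 1`, the local term `t_q(D) ≠ 0`.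
[cite: McCallumLMS1991, §5 Lemma 5.3 and proof of Thm. 5.4] [cite: MilneADT2006, Ch. I, Cor. 2.3, Thm. 3.2, proof of Prop. 6.9] -/
theorem localTerm_canonical_ne_zero_of_kolPrime (hΔ : W.Δ < 0) {L q : ℕ} (hq : kolPrime W K (L + L) q)
    (hL : L ≠ 0)
    (e : geomTorsion W ((2 ^ L * 2 ^ L : ℕ) : ℤ) → geomTorsion W ((2 ^ L * 2 ^ L : ℕ) : ℤ) → AlgebraicClosure ℚ)
    (hμ : ∀ S T, e S T ^ (2 ^ L * 2 ^ L) = 1)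
    (hadd₁ : ∀ S₁ S₂ T, e (S₁ + S₂) T = e S₁ T * e S₂ T)
    (hadd₂ : ∀ S T₁ T₂, e S (T₁ + T₂) = e S T₁ * e S T₂)
    (hgal : ∀ (σ : absoluteGaloisGroup ℚ) (S T : geomTorsion W ((2 ^ L * 2 ^ L : ℕ) : ℤ)),
      σ • e S T = e (σ • S) (σ • T))
    (halt : ∀ T, e T T = 1) (hnondeg : ∀ T, (∀ S, e S T = 1) → T = 0)
    (D : FirstCaseData W (2 ^ L)) {a b : ℕ}
    (hx : ((2 : ℤ) ^ a) • galoisCohomology.res (W.torsionGaloisModule ((2 ^ L * 2 ^ L : ℕ) : ℤ))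
        ((primesEquiv.symm ⟨q, hq.1⟩ : HeightOneSpectrum (𝓞 ℚ)).adicCompletion ℚ) 1 D.b₁ ∉
      W.kummerLocalConditionAt ((2 ^ L * 2 ^ L : ℕ) : ℤ) ((primesEquiv.symm ⟨q, hq.1⟩ : HeightOneSpectrum (𝓞 ℚ)).adicCompletion ℚ))
    (hyb : ((2 : ℤ) ^ b) • D.β' (Sum.inr (primesEquiv.symm ⟨q, hq.1⟩)) ≠ 0) (hn : L + L ≤ a + b + 1) :
    D.localTerm e hμ hadd₁ hadd₂ hgal (LocalInvariants.canonical ℚ (2 ^ L * 2 ^ L))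
      (Sum.inr (primesEquiv.symm ⟨q, hq.1⟩)) ≠ 0 := by
  obtain ⟨hqp, hq2, -, hgood, -, hF2, hidx, -⟩ := id hq
  haveI : Fact q.Prime := ⟨hqp⟩
  haveI : NeZero (2 ^ L * 2 ^ L) := ⟨by positivity⟩
  have hv : (q : 𝓞 ℚ) ∈ (primesEquiv.symm ⟨q, hqp⟩ : HeightOneSpectrum (𝓞 ℚ)).asIdeal :=
    natCast_mem_primesEquiv_symm hqp
  have hmn : 2 ^ L * 2 ^ L = 2 ^ (L + L) := (pow_add 2 L L).symm
  -- `#H¹(ℚ_q, E)[2^L · 2^L] = 2^{L+L}` and `#H¹(ℚ_q, E)[2] = 2` (Tate local duality off `2`)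
  have hT : Nat.card (AddSubgroup.torsionBy (galoisCohomology (W.localGaloisModule
      ((primesEquiv.symm ⟨q, hqp⟩ : HeightOneSpectrum (𝓞 ℚ)).adicCompletion ℚ)) 1)
        ((2 ^ L * 2 ^ L : ℕ) : ℤ)) = 2 ^ (L + L) := by
    rw [hmn]
    exact natCard_torsionBy_localH1_two_pow_eq W hΔ hq2 hgood hF2 hv (by omega) hidx
  have hT₁ : Nat.card (AddSubgroup.torsionBy (galoisCohomology (W.localGaloisModule
      ((primesEquiv.symm ⟨q, hqp⟩ : HeightOneSpectrum (𝓞 ℚ)).adicCompletion ℚ)) 1) ((2 : ℕ) : ℤ)) = 2 := by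
    have h := natCard_torsionBy_localH1_two_pow_eq W hΔ hq2 hgood hF2 hv (M := 1) one_ne_zero (by omega)
    simpa only [pow_one] using h
  have hinv : Injective (LocalInvariants.canonical ℚ (2 ^ L * 2 ^ L) (Sum.inr (primesEquiv.symm ⟨q, hqp⟩))) :=
    (LocalInvariants.canonical_isPerfect (K := ℚ) (n := 2 ^ L * 2 ^ L) (primesEquiv.symm ⟨q, hqp⟩)).1.1
  -- the generic lemma over `F = ℚ_q` (its `CharZero` instance passed explicitly: no `ℚ`-algebra diamond)
  exact @ctLocalTerm_ne_zero_of_orders ℚ _ _ W _ (2 ^ L) _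
    ((primesEquiv.symm ⟨q, hqp⟩ : HeightOneSpectrum (𝓞 ℚ)).adicCompletion ℚ) _ _
    (Summit.BirchSwinnertonDyer.BirchSwinnertonDyer.Theorems.GenusExact.ReductionCyclic.charZero_adicCompletion _)
    _ _ _ e hμ hadd₁ hadd₂ hgal halt hnondeg 2 (L + L) Nat.prime_two hmn hT hT₁
    (LocalInvariants.canonical ℚ (2 ^ L * 2 ^ L) (Sum.inr (primesEquiv.symm ⟨q, hqp⟩))) hinv D.b₁
    (D.β (Sum.inr (primesEquiv.symm ⟨q, hqp⟩))) (D.β' (Sum.inr (primesEquiv.symm ⟨q, hqp⟩)))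
    (D.β_mem (Sum.inr (primesEquiv.symm ⟨q, hqp⟩))) (D.β'_mem (Sum.inr (primesEquiv.symm ⟨q, hqp⟩)))
    a b hx hyb hn


/-- **The same for the twin `E' = E^{(d_K)}`** (`twin W K`, any model: the twin's counts
`#H¹(ℚ_q, E')[2^k] = #E'(ℚ_q)[2^k] = 2^k` are this lineage's `natCard_torsionBy_localH1_eq_of_not_mem` and
`natCard_ker_nsmul_quadraticTwist_adicCompletion_two_pow_eq`, McCallum Lemma 5.3 (i), `−`-part, over `ℚ_q`):
for first-case data `D` of the twin at level `2^L` with `2^a · res_q b₁ ∉ 𝓛_q`, `2^b · β'_q ≠ 0` and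
`L + L ≤ a + b + 1`, the local term `t_q(D) ≠ 0` for `inv = LocalInvariants.canonical`.
[cite: McCallumLMS1991, §5 Lemma 5.3 and proof of Thm. 5.4] [cite: MilneADT2006, Ch. I, Cor. 2.3, Thm. 3.2, proof of Prop. 6.9] -/
theorem localTerm_canonical_ne_zero_twin_of_kolPrime [(twin W K).IsElliptic] (hK : IsImaginaryQuadratic K)
    (hodd : Odd (NumberField.discr K)) (hΔ : W.Δ < 0) {L q : ℕ} (hq : kolPrime W K (L + L) q) (hL : L ≠ 0)
    (e : geomTorsion (twin W K) ((2 ^ L * 2 ^ L : ℕ) : ℤ) → geomTorsion (twin W K) ((2 ^ L * 2 ^ L : ℕ) : ℤ) →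
      AlgebraicClosure ℚ)
    (hμ : ∀ S T, e S T ^ (2 ^ L * 2 ^ L) = 1)
    (hadd₁ : ∀ S₁ S₂ T, e (S₁ + S₂) T = e S₁ T * e S₂ T)
    (hadd₂ : ∀ S T₁ T₂, e S (T₁ + T₂) = e S T₁ * e S T₂)
    (hgal : ∀ (σ : absoluteGaloisGroup ℚ) (S T : geomTorsion (twin W K) ((2 ^ L * 2 ^ L : ℕ) : ℤ)),
      σ • e S T = e (σ • S) (σ • T))
    (halt : ∀ T, e T T = 1) (hnondeg : ∀ T, (∀ S, e S T = 1) → T = 0)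
    (D : FirstCaseData (twin W K) (2 ^ L)) {a b : ℕ}
    (hx : ((2 : ℤ) ^ a) • galoisCohomology.res ((twin W K).torsionGaloisModule ((2 ^ L * 2 ^ L : ℕ) : ℤ))
        ((primesEquiv.symm ⟨q, hq.1⟩ : HeightOneSpectrum (𝓞 ℚ)).adicCompletion ℚ) 1 D.b₁ ∉
      (twin W K).kummerLocalConditionAt ((2 ^ L * 2 ^ L : ℕ) : ℤ)
        ((primesEquiv.symm ⟨q, hq.1⟩ : HeightOneSpectrum (𝓞 ℚ)).adicCompletion ℚ))
    (hyb : ((2 : ℤ) ^ b) • D.β' (Sum.inr (primesEquiv.symm ⟨q, hq.1⟩)) ≠ 0) (hn : L + L ≤ a + b + 1) :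
    D.localTerm e hμ hadd₁ hadd₂ hgal (LocalInvariants.canonical ℚ (2 ^ L * 2 ^ L))
      (Sum.inr (primesEquiv.symm ⟨q, hq.1⟩)) ≠ 0 := by
  obtain ⟨hqp, hq2, hqd, hgood, -, hF2, hidx, -⟩ := id hq
  haveI : Fact q.Prime := ⟨hqp⟩
  haveI : NeZero (2 ^ L * 2 ^ L) := ⟨by positivity⟩
  have hv : (q : 𝓞 ℚ) ∈ (primesEquiv.symm ⟨q, hqp⟩ : HeightOneSpectrum (𝓞 ℚ)).asIdeal :=
    natCast_mem_primesEquiv_symm hqp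
  have h2v : ((2 : ℕ) : 𝓞 ℚ) ∉ (primesEquiv.symm ⟨q, hqp⟩ : HeightOneSpectrum (𝓞 ℚ)).asIdeal :=
    two_notMem_of_odd_prime_mem hq2 hv
  have hmn : 2 ^ L * 2 ^ L = 2 ^ (L + L) := (pow_add 2 L L).symm
  -- `#H¹(ℚ_q, E')[2^k] = #E'(ℚ_q)[2^k] = 2^k` for `k = L + L` and `k = 1`
  have hcount : ∀ {k : ℕ}, k ≠ 0 → k ≤ L + L →
      Nat.card (AddSubgroup.torsionBy (galoisCohomology ((twin W K).localGaloisModule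
        ((primesEquiv.symm ⟨q, hqp⟩ : HeightOneSpectrum (𝓞 ℚ)).adicCompletion ℚ)) 1) ((2 ^ k : ℕ) : ℤ)) =
        2 ^ k := fun {k} hk hkL => by
    rw [natCard_torsionBy_localH1_eq_of_not_mem (primesEquiv.symm ⟨q, hqp⟩) (twin W K) hk h2v]
    exact Summit.BirchSwinnertonDyer.BirchSwinnertonDyer.Theorems.GenusExact.FrobeniusCriterion.natCard_ker_nsmul_quadraticTwist_adicCompletion_two_pow_eq
      W hK hodd hΔ hq2 hqd hgood hF2 hv (hkL.trans hidx) rfl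
  have hT : Nat.card (AddSubgroup.torsionBy (galoisCohomology ((twin W K).localGaloisModule
      ((primesEquiv.symm ⟨q, hqp⟩ : HeightOneSpectrum (𝓞 ℚ)).adicCompletion ℚ)) 1)
        ((2 ^ L * 2 ^ L : ℕ) : ℤ)) = 2 ^ (L + L) := by
    rw [hmn]
    exact hcount (by omega) le_rfl
  have hT₁ : Nat.card (AddSubgroup.torsionBy (galoisCohomology ((twin W K).localGaloisModule
      ((primesEquiv.symm ⟨q, hqp⟩ : HeightOneSpectrum (𝓞 ℚ)).adicCompletion ℚ)) 1) ((2 : ℕ) : ℤ)) = 2 := by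
    have h := hcount (k := 1) one_ne_zero (by omega)
    simpa only [pow_one] using h
  have hinv : Injective (LocalInvariants.canonical ℚ (2 ^ L * 2 ^ L) (Sum.inr (primesEquiv.symm ⟨q, hqp⟩))) :=
    (LocalInvariants.canonical_isPerfect (K := ℚ) (n := 2 ^ L * 2 ^ L) (primesEquiv.symm ⟨q, hqp⟩)).1.1
  exact @ctLocalTerm_ne_zero_of_orders ℚ _ _ (twin W K) _ (2 ^ L) _
    ((primesEquiv.symm ⟨q, hqp⟩ : HeightOneSpectrum (𝓞 ℚ)).adicCompletion ℚ) _ _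
    (Summit.BirchSwinnertonDyer.BirchSwinnertonDyer.Theorems.GenusExact.ReductionCyclic.charZero_adicCompletion _)
    _ _ _ e hμ hadd₁ hadd₂ hgal halt hnondeg 2 (L + L) Nat.prime_two hmn hT hT₁
    (LocalInvariants.canonical ℚ (2 ^ L * 2 ^ L) (Sum.inr (primesEquiv.symm ⟨q, hqp⟩))) hinv D.b₁
    (D.β (Sum.inr (primesEquiv.symm ⟨q, hqp⟩))) (D.β' (Sum.inr (primesEquiv.symm ⟨q, hqp⟩)))
    (D.β_mem (Sum.inr (primesEquiv.symm ⟨q, hqp⟩))) (D.β'_mem (Sum.inr (primesEquiv.symm ⟨q, hqp⟩)))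
    a b hx hyb hn

end Instance

end Summit.BirchSwinnertonDyer.BirchSwinnertonDyer.Theorems.GenusExact.VisiblePairAtTwo

end
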